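import Summits.NavierStokesRegularity.FluidComputer.GateBudgetSwingFloorLock
import Summits.NavierStokesRegularity.FluidComputer.GateBudgetSwingPrice
import HarnessLib

/-!
# GateBudget part 112 — the swing transfer from below, IV: the floor on the windows (§298–§299)

Cell `pub-fluidc`, blueprint seat bp1 (gen 39, seventh item); namespace
`Summit.NavierStokesRegularity.FluidComputer.GateBudget`, headline family
`RotorKnob.rotorCircuit K K¹⁰ ε ρ` (modes `0 = a` carrier, `1 = b` clock, `2 = c` trigger,
`3 = d` transfer, `4 = ã` output) from `delayInit`, trigger primitive `C` (`C' = c`). Imports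
part 111 (`GateBudgetSwingFloorLock`: the headline band floor; through it parts 109–110) and
part 104 (`GateBudgetSwingPrice`: the windows and the price from above; through it part 103).
HONEST FRAMING: a low prior, high value-of-information experiment on Tao's machine paradigm;
NOT a claim that NS blows up. Nothing here is about the Navier–Stokes equations.

THE POINT (SPEC-INPUT-bp1 §CH(3)(b); the necessity side of the swing law, fourth file — the
lower twin of part 104). Part 111 §297 bounds the output swing across the headline band
`b ∈ [-(31/32)θε, (31/32)θε]` of one pulse (unit lattice `ε = K¹⁰ρ²`, `θ ≥ 5/4`, `K ≥ 16`)
FROM BELOW by `COEF·FLOOR`, `COEF ≥ (999/1000)·a(r)²/(θK⁹)` and `FLOOR = (cos 2ψ₁ + cos 2ψ₂)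
(cos α₁ - ((1 - κ)π/2 + 10⁻⁵)) - (|sin 2ψ₁| + |sin 2ψ₂|)(1 - sin α₁) + 2E₁(log sin(α₁/2)
- log cos(α₁/2))` (`κ = 9999/10000`), symbolic in the edge angle `α₁ = arccos((31/32)θε/R₂)`
and the phase offsets `ψ₁`, `ψ₂` — exactly the quantities part 104 §285 put in WINDOWS
(`arccos ∈ [0.2499, 0.2510]`, climb phase `∈ [0.2480, 0.2561]`, band excess
`∈ [-0.0022, 0.0004]`, hence `|sin ψ₁| ≤ 0.0063`, `|sin ψ₂| ≤ 0.0067`). This file turns FLOOR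
into a NUMBER with part 104's own devices.
(§298) With `y = cos α₁ ∈ [31/32, (31/32)(1 + 2/10⁵)]`, `|sin ψᵢ| ≤ σᵢ`, `σ₁² + σ₂² ≤ 1`,
`E₁ ≥ 0`: `cos 2ψ₁ + cos 2ψ₂ = 2 - 2(sin²ψ₁ + sin²ψ₂) ≥ 2 - 2(σ₁² + σ₂²) ≥ 0`,
`(1 - κ)π/2 + 10⁻⁵ ≤ 1675/10⁷` (`π < 3.15`), `|sin 2ψ| ≤ 2σ`, `1 - sin α₁ ≤ 0.7521`,
`log sin(α₁/2) - log cos(α₁/2) = -½ log((1 + y)/(1 - y)) ≥ -3 log 2 ≥ -2.0795`, so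
`FLOOR ≥ (2 - 2(σ₁² + σ₂²))(y - 1675/10⁷) - 1.5042(σ₁ + σ₂) - 2.0795·2E₁`.
(§299) THE HEADLINE SWING FLOOR: on part 104's windows (`σ₁ = 0.0063`, `σ₂ = 0.0067`,
`E₁ = E + π/9999`) the bracket is `≥ 1.916 - 4.16E`, hence
`ã(t₂) - ã(t₁) ≥ (999/1000)·(a(r)²/(θK⁹))·(1.916 - 4.16E)` under EXACTLY the hypotheses of
part 104 §286 `swing_headline_price`, whose ceiling is `(1 + 2/10⁴)·(a(r)²/(θK⁹))·(1.96
+ 4.16E)`: the TWO-SIDED HEADLINE SWING (both in one theorem), and the per-band number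
`ã(t₂) - ã(t₁) ≥ 1.289/K⁹` once `a(r)² ≥ 0.979`, `θ ≤ 29/20`, `E ≤ 10⁻³` (part 71's crude
floor: `1/K⁹` per clean misfire; forecast necessity ceiling `K⁹/(7·1.289) + 1 ≈ 0.1108K⁹ + 1`
after the re-count of part 72 §219, against `K⁹/7 + 1`).

* §298 `swing_price_windows_ge` (pure real analysis, displayed above).
* §299 `swing_headline_floor` (THE NUMBER FROM BELOW; hypotheses = part 104 §286's);
  `swing_headline_two_sided` (floor and part 104's ceiling together);
  `swing_headline_floor_band` (`≥ 1.289/K⁹` for `a(r)² ≥ 0.979`, `θ ≤ 29/20`, `E ≤ 10⁻³`).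

NUMBERS. `(2 - 2(0.0063² + 0.0067²))(31/32 - 1675/10⁷) - 1.5042·0.013 - 4.159·3.15/9999
= 1.93700 - 0.01955 - 0.00131 = 1.91614 ≥ 1.916`; `4.159 ≤ 4.16`; `0.999·0.979·(1.916 - 0.00416)
/1.45 = 1.2895 ≥ 1.289`; ceiling side (part 104): `1.0002·(1.96 + 4.16E)`; the two coefficients
differ by `0.12 %`, the two brackets by `2.3 %` (`(1 - κ)π/2`, `E₁ log tan(α₁/2)` change sign).
HONEST LIMITS. (i) `k = 1` (unit lattice) only, as parts 100–111; (ii) the drift `E` is left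
symbolic, as in part 104 (on part 97's ladder `E ≤ 5·10⁻⁶` at `K = 16`; `E ≤ 10⁻³` is what
§299(c) asks); (iii) the re-count of part 72 §218–§219 with `1.289/K⁹` in place of `1/K⁹` is
part 113 — until then `N ≤ K⁹/7 + 1` STANDS and `0.1108K⁹ + 1` is a FORECAST; (iv) `1.916` has
slack `1.4·10⁻⁴` only (`π < 3.15` used; true bracket `≈ 1.9165`); (v) nothing about NS.
[cite: Tao2016AveragedNS, §5.5 Theorem 5.3, (5.5), (b-eq), (c-eq), (d-eq), (ta-eq),
(energy-con)]
-/

noncomputable section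

namespace Summit.NavierStokesRegularity.FluidComputer.GateBudget

open Real Set Filter Topology
open Literature.Analysis.FluidPDE.Tao2016AveragedNS

variable {K M ε ρ : ℝ} {X : ℝ → Fin 5 → ℝ} {C : ℝ → ℝ}

/-! ## §298 The floor bracket on the windows -/

/-- §298 THE FLOOR BRACKET ON THE WINDOWS (pure real analysis): for an edge cosine
`y ∈ [31/32, (31/32)(1 + 2/10⁵)]`, `α₁ = arccos y`, offsets with `|sin ψᵢ| ≤ σᵢ`,
`σ₁² + σ₂² ≤ 1`, and a drift `E₁ ≥ 0`, the floor bracket of part 111 §297 (`κ = 9999/10000`,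
`δ = 10⁻⁵`) is `≥ (2 - 2(σ₁² + σ₂²))(y - 1675/10⁷) - (7521/5000)(σ₁ + σ₂) - (20795/10000)·2E₁`
(`cos² - sin² = 1 - 2 sin²`; `(1 - κ)π/2 + δ ≤ 1675/10⁷`; `|sin 2ψ| ≤ 2|sin ψ|`,
`1 - sin α₁ ≤ 1 - 0.2479`; `log sin(α₁/2) - log cos(α₁/2) = -½ log((1 + y)/(1 - y))
≥ -3 log 2 ≥ -2.0795`).
[derived: Mathlib (`Real.cos_arccos`, `Real.sin_arccos`, `Real.cos_sq`, `Real.log_two_lt_d9`,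
`Real.pi_lt_d2`); part 104 §284 (the same four devices)] -/
theorem swing_price_windows_ge {y α₁ ψ₁ ψ₂ σ₁ σ₂ E₁ : ℝ} (hy1 : 31 / 32 ≤ y)
    (hy2 : y ≤ 31 / 32 * (1 + 2 / 10 ^ 5)) (hα₁ : α₁ = arccos y) (hσ₁ : |sin ψ₁| ≤ σ₁)
    (hσ₂ : |sin ψ₂| ≤ σ₂) (hσ : σ₁ ^ 2 + σ₂ ^ 2 ≤ 1) (hE₁ : 0 ≤ E₁) :
    (2 - 2 * (σ₁ ^ 2 + σ₂ ^ 2)) * (y - 1675 / 10 ^ 7) - 7521 / 5000 * (σ₁ + σ₂)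
        - 20795 / 10000 * (2 * E₁)
      ≤ (cos ψ₁ ^ 2 - sin ψ₁ ^ 2 + (cos ψ₂ ^ 2 - sin ψ₂ ^ 2))
            * (cos α₁ - ((1 - 9999 / 10000) * (π / 2) + 1 / 10 ^ 5))
          - (|sin (2 * ψ₁)| + |sin (2 * ψ₂)|) * (1 - sin α₁)
          + 2 * E₁ * (log (sin (α₁ / 2)) - log (cos (α₁ / 2))) := by
  have hy0 : 0 ≤ y := by linarith
  have hy3 : y < 1 := by linarith
  have hcos : cos α₁ = y := by rw [hα₁]; exact cos_arccos (by linarith) hy3.le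
  have hsin : sin α₁ = √(1 - y ^ 2) := by rw [hα₁, sin_arccos]
  have hs1 : 2479 / 10000 ≤ sin α₁ := by
    rw [hsin]
    calc (2479 / 10000 : ℝ) = √((2479 / 10000) ^ 2) := (sqrt_sq (by norm_num)).symm
      _ ≤ √(1 - y ^ 2) := sqrt_le_sqrt (by nlinarith [mul_nonneg (sub_nonneg.2 hy2) hy0])
  have hs2 : sin α₁ ≤ 1 := sin_le_one _
  -- the cosine term: `cos 2ψ₁ + cos 2ψ₂ ≥ 2 - 2(σ₁² + σ₂²) ≥ 0`, `y - ((1 - κ)π/2 + δ) ≥ 0`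
  have a1 : sin ψ₁ ^ 2 ≤ σ₁ ^ 2 := by
    rw [← sq_abs (sin ψ₁)]; exact pow_le_pow_left₀ (abs_nonneg _) hσ₁ 2
  have a2 : sin ψ₂ ^ 2 ≤ σ₂ ^ 2 := by
    rw [← sq_abs (sin ψ₂)]; exact pow_le_pow_left₀ (abs_nonneg _) hσ₂ 2
  have hF : 2 - 2 * (σ₁ ^ 2 + σ₂ ^ 2)
      ≤ cos ψ₁ ^ 2 - sin ψ₁ ^ 2 + (cos ψ₂ ^ 2 - sin ψ₂ ^ 2) := by
    have c1 := sin_sq_add_cos_sq ψ₁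
    have c2 := sin_sq_add_cos_sq ψ₂
    linarith
  have hF0 : 0 ≤ 2 - 2 * (σ₁ ^ 2 + σ₂ ^ 2) := by linarith
  have hπ := Real.pi_lt_d2
  have hG : y - 1675 / 10 ^ 7 ≤ cos α₁ - ((1 - 9999 / 10000) * (π / 2) + 1 / 10 ^ 5) := by
    rw [hcos]; linarith
  have hG0 : 0 ≤ cos α₁ - ((1 - 9999 / 10000) * (π / 2) + 1 / 10 ^ 5) := by linarith
  have h1 : (2 - 2 * (σ₁ ^ 2 + σ₂ ^ 2)) * (y - 1675 / 10 ^ 7)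
      ≤ (cos ψ₁ ^ 2 - sin ψ₁ ^ 2 + (cos ψ₂ ^ 2 - sin ψ₂ ^ 2))
        * (cos α₁ - ((1 - 9999 / 10000) * (π / 2) + 1 / 10 ^ 5)) :=
    (mul_le_mul_of_nonneg_left hG hF0).trans (mul_le_mul_of_nonneg_right hF hG0)
  -- the double-angle term (part 104 §284 verbatim)
  have hσ0 : 0 ≤ σ₁ := (abs_nonneg _).trans hσ₁
  have hσ0' : 0 ≤ σ₂ := (abs_nonneg _).trans hσ₂
  have h2a : ∀ {ψ σ : ℝ}, |sin ψ| ≤ σ → |sin (2 * ψ)| ≤ 2 * σ := by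
    intro ψ σ h
    rw [sin_two_mul, abs_mul, abs_mul, abs_two]
    have hm := mul_le_mul h (abs_cos_le_one ψ) (abs_nonneg _) ((abs_nonneg _).trans h)
    linarith
  have h2 : (|sin (2 * ψ₁)| + |sin (2 * ψ₂)|) * (1 - sin α₁) ≤ 7521 / 5000 * (σ₁ + σ₂) := by
    calc (|sin (2 * ψ₁)| + |sin (2 * ψ₂)|) * (1 - sin α₁)
        ≤ (2 * σ₁ + 2 * σ₂) * (7521 / 10000) :=
          mul_le_mul (add_le_add (h2a hσ₁) (h2a hσ₂)) (by linarith) (by linarith) (by linarith)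
      _ = 7521 / 5000 * (σ₁ + σ₂) := by ring
  -- the half-angle logarithm (part 104 §284 verbatim, read from below)
  have hc2 : cos (α₁ / 2) ^ 2 = (1 + y) / 2 := by
    rw [cos_sq, show 2 * (α₁ / 2) = α₁ by ring, hcos]; ring
  have hs2' : sin (α₁ / 2) ^ 2 = (1 - y) / 2 := by rw [sin_sq, hc2]; ring
  have e1 : log ((1 - y) / 2) = 2 * log (sin (α₁ / 2)) := by
    rw [← hs2', Real.log_pow]; norm_num
  have e2 : log ((1 + y) / 2) = 2 * log (cos (α₁ / 2)) := by
    rw [← hc2, Real.log_pow]; norm_num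
  rw [Real.log_div (show (0 : ℝ) < 1 - y by linarith).ne' (by norm_num)] at e1
  rw [Real.log_div (show (0 : ℝ) < 1 + y by linarith).ne' (by norm_num)] at e2
  have hL : log (1 + y) - log (1 - y) ≤ 6 * log 2 := by
    rw [← Real.log_div (show (0 : ℝ) < 1 + y by linarith).ne'
      (show (0 : ℝ) < 1 - y by linarith).ne']
    have h64 : (1 + y) / (1 - y) ≤ 2 ^ 6 := by
      rw [div_le_iff₀ (by linarith)]; linarith
    calc log ((1 + y) / (1 - y)) ≤ log (2 ^ 6) :=
          Real.log_le_log (div_pos (by linarith) (by linarith)) h64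
      _ = 6 * log 2 := by rw [Real.log_pow]; norm_num
  have hlog2 := Real.log_two_lt_d9
  have h3 : -(20795 / 10000 * (2 * E₁))
      ≤ 2 * E₁ * (log (sin (α₁ / 2)) - log (cos (α₁ / 2))) := by
    have hℓ : log (sin (α₁ / 2)) - log (cos (α₁ / 2)) = -((log (1 + y) - log (1 - y)) / 2) := by
      linarith
    rw [hℓ]
    have hE2 : 0 ≤ 2 * E₁ := by linarith
    calc -(20795 / 10000 * (2 * E₁)) = 2 * E₁ * (-(20795 / 10000)) := by ring
      _ ≤ 2 * E₁ * (-((log (1 + y) - log (1 - y)) / 2)) :=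
          mul_le_mul_of_nonneg_left (by linarith) hE2
  linarith [h1, h2, h3]

/-! ## §299 The headline swing floor -/

/-- §299(a) THE HEADLINE SWING FLOOR (EXACTLY the hypotheses of part 104 §286
`swing_headline_price`: headline member `K ≥ 16`, `ε > 0`, UNIT LATTICE `ε = K¹⁰ρ²`,
`θ ≥ 5/4`; a pulse start `r ≥ 0` with `c(r) = ρ²/K⁹`, an end `T' ≤ r + 242/K⁹`, the kept ring
`θ²ε² - ε²/10⁶ ≤ b² + c² ≤ θ²ε² + 2ε²/10⁶` and `c > 0` on `[r, T']`, `a(r) ≠ 0`; the symmetric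
band `r ≤ t₁ ≤ t₂ ≤ T'`, `b(t₁) = (31/32)θε = -b(t₂)`, `|b| ≤ (31/32)θε` on `[t₁, t₂]`, and
the dose sandwich at `t₁` — part 100 §277 `pulse_swing_band` supplies all of it;
`E = (|d(r)| + d(r)² + 6(ε + ρ²e^{-K¹⁰} + Kã(T'))(T' - r))/a(r)²`):
`ã(t₂) - ã(t₁) ≥ (999/1000)·a(r)²/(θK⁹)·(1.916 - 4.16E)` (part 111 §297(b),(c) on part 104
§285's windows via §298; if `1.916 - 4.16E < 0` the bound is the monotonicity of `ã`).
[derived: part 111 §297(b),(c); part 104 §285; this file §298; RotorKnob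
(`rotorCircuit_output_monotone`)] -/
theorem swing_headline_floor
    (hX : ∀ t, HasDerivAt X (RotorKnob.rotorCircuit K (K ^ 10) ε ρ (X t)) t)
    (h0 : X 0 = delayInit) (hC : ∀ t, HasDerivAt C (X t 2) t) (hK : 16 ≤ K) (hε : 0 < ε)
    (hlat : ε = K ^ 10 * ρ ^ 2) {r t₁ t₂ T' θ : ℝ} (hr : 0 ≤ r) (hrt : r ≤ t₁) (ht : t₁ ≤ t₂)
    (htT : t₂ ≤ T') (hτ : T' - r ≤ 242 / K ^ 9) (hθ1 : 5 / 4 ≤ θ) (ha : X r 0 ≠ 0)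
    (hcr : X r 2 = ρ ^ 2 / K ^ 9)
    (hring : ∀ u ∈ Icc r T', θ ^ 2 * ε ^ 2 - ε ^ 2 / 10 ^ 6 ≤ X u 1 ^ 2 + X u 2 ^ 2 ∧
      X u 1 ^ 2 + X u 2 ^ 2 ≤ θ ^ 2 * ε ^ 2 + 2 * ε ^ 2 / 10 ^ 6)
    (hpos : ∀ u ∈ Icc r T', 0 < X u 2) (hb1 : X t₁ 1 = 31 / 32 * θ * ε)
    (hb2 : X t₂ 1 = -(31 / 32 * θ * ε))
    (hband : ∀ u ∈ Icc t₁ t₂, -(31 / 32 * θ * ε) ≤ X u 1 ∧ X u 1 ≤ 31 / 32 * θ * ε)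
    (hdlo : 31 / 32 * θ * K ^ 10 * (C t₁ - C r) ≤ X t₁ 2 - X r 2)
    (hdhi : X t₁ 2 - X r 2 ≤ (1 + 1 / 10 ^ 4) * θ * K ^ 10 * (C t₁ - C r)
      + ρ ^ 2 * exp (-K ^ 10) * (t₁ - r)) {E : ℝ}
    (hE : E = (|X r 3| + X r 3 ^ 2 + 6 * (ε + ρ ^ 2 * exp (-K ^ 10) + K * X T' 4) * (T' - r))
      / X r 0 ^ 2) :
    999 / 1000 * X r 0 ^ 2 / (θ * K ^ 9) * (1916 / 1000 - 416 / 100 * E) ≤ X t₂ 4 - X t₁ 4 := by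
  have hK0 : (0 : ℝ) < K := by linarith
  have hθ0 : (0 : ℝ) < θ := by linarith
  obtain ⟨R₂, hR₂⟩ : ∃ R₂ : ℝ, R₂ = √(θ ^ 2 * ε ^ 2 - ε ^ 2 / 10 ^ 6 - ε ^ 2 / K ^ 10) :=
    ⟨_, rfl⟩
  obtain ⟨α₁, hα₁⟩ : ∃ α₁ : ℝ, α₁ = arccos (31 / 32 * θ * ε / R₂) := ⟨_, rfl⟩
  obtain ⟨ψ₁, hψ₁⟩ : ∃ ψ₁ : ℝ, ψ₁ = (C t₁ - C r) / ρ ^ 2 - α₁ := ⟨_, rfl⟩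
  obtain ⟨ψ₂, hψ₂⟩ : ∃ ψ₂ : ℝ,
      ψ₂ = -(α₁ + (C t₁ - C r) / ρ ^ 2 + ε⁻¹ * K ^ 10 * (C t₂ - C t₁)) := ⟨_, rfl⟩
  have h9 : ((9999 / 10000 : ℝ)⁻¹ - 1) = 1 / 9999 := by norm_num
  obtain ⟨E₁, hE₁⟩ : ∃ E₁ : ℝ, E₁ = E + π * ((9999 / 10000 : ℝ)⁻¹ - 1) := ⟨_, rfl⟩
  obtain ⟨η, hη⟩ : ∃ η : ℝ, η = 9999 / 10000
      / (1 + (2 * (1 / 10 ^ 5) + π / 2 * ((9999 / 10000 : ℝ)⁻¹ - 1)) / sin α₁) := ⟨_, rfl⟩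
  obtain ⟨-, hy1, hy2⟩ := swing_coef_headline hK hε hθ1 (le_refl (0 : ℝ)) hR₂
  obtain ⟨hη9, -, hcoef⟩ := swing_coef_headline_ge hK hε hθ1 (sq_nonneg (X r 0)) hR₂ hα₁ hη
  -- the windows (part 104 §286 verbatim)
  have hsub1 : t₁ ∈ Icc r T' := ⟨hrt, ht.trans htT⟩
  have hsubI : ∀ u ∈ Icc t₁ t₂, u ∈ Icc r T' := fun u hu => ⟨hrt.trans hu.1, hu.2.trans htT⟩
  obtain ⟨hΦ1, hΦ2⟩ := climb_phase_window hK hε hlat hθ1 hrt (by linarith only [hτ, hsub1.2])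
    hb1 hcr (hring t₁ hsub1) (hpos t₁ hsub1) hdlo hdhi
  obtain ⟨hαlo, hαhi⟩ := edge_angle_window (by linarith only [hy1]) hy2
  rw [← hα₁] at hαlo hαhi
  obtain ⟨hδ1, hδ2⟩ := band_excess_window hX h0 hC hK hε ht hθ1 (fun u hu => hring u (hsubI u hu))
    (fun u hu => hpos u (hsubI u hu)) hb1 hb2 hband hR₂ hα₁
  -- the phase offsets
  have hψlo : -(30 / 10000) ≤ ψ₁ := by rw [hψ₁]; linarith only [hΦ1, hαhi]
  have hψhi : ψ₁ ≤ 62 / 10000 := by rw [hψ₁]; linarith only [hΦ2, hαlo]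
  have hσ₁ : |sin ψ₁| ≤ 63 / 10000 :=
    abs_sin_le_abs.trans (abs_le.2 ⟨by linarith only [hψlo], by linarith only [hψhi]⟩)
  have hsin2 : sin ψ₂ = sin (ψ₁ + (ε⁻¹ * K ^ 10 * (C t₂ - C t₁) - (π - 2 * α₁))) := by
    have e : ψ₂ = -((ψ₁ + (ε⁻¹ * K ^ 10 * (C t₂ - C t₁) - (π - 2 * α₁))) + π) := by
      rw [hψ₂, hψ₁]; ring
    rw [e, sin_neg, sin_add_pi, neg_neg]
  have hσ₂ : |sin ψ₂| ≤ 67 / 10000 := by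
    rw [hsin2]
    exact abs_sin_le_abs.trans (abs_le.2 ⟨by linarith only [hψlo, hδ1],
      by linarith only [hψhi, hδ2]⟩)
  have hcψ : sin ψ₁ ^ 2 + sin ψ₂ ^ 2 ≤ 1 := by
    have a1 : sin ψ₁ ^ 2 ≤ (63 / 10000) ^ 2 := by
      rw [← sq_abs (sin ψ₁)]; exact pow_le_pow_left₀ (abs_nonneg _) hσ₁ 2
    have a2 : sin ψ₂ ^ 2 ≤ (67 / 10000) ^ 2 := by
      rw [← sq_abs (sin ψ₂)]; exact pow_le_pow_left₀ (abs_nonneg _) hσ₂ 2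
    linarith only [a1, a2]
  -- the band floor of part 111 §297(b)
  have hmain := swing_band_headline_ge hX h0 hC hK hε hlat hr hrt ht htT hθ1 ha hring hpos hb1
    hb2 hband hR₂ hE hα₁ hψ₁ hψ₂ hE₁ hη hcψ
  -- the drift is nonnegative
  have hE0 : 0 ≤ E := by
    rw [hE]
    have hT0 : 0 ≤ T' := hr.trans (hrt.trans (ht.trans htT))
    have he := RotorKnob.e_nonneg hX h0 hK0.le hT0
    have hτ0 : 0 ≤ T' - r := by linarith only [hrt, ht, htT]
    positivity
  rw [h9] at hE₁
  have hE₁0 : 0 ≤ E₁ := by rw [hE₁]; positivity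
  have hprice := swing_price_windows_ge hy1 hy2 hα₁ hσ₁ hσ₂ (by norm_num) hE₁0
  have hπ := Real.pi_lt_d2
  have hB : 1916 / 1000 - 416 / 100 * E
      ≤ (2 - 2 * ((63 / 10000) ^ 2 + (67 / 10000) ^ 2)) * (31 / 32 * θ * ε / R₂ - 1675 / 10 ^ 7)
        - 7521 / 5000 * (63 / 10000 + 67 / 10000) - 20795 / 10000 * (2 * E₁) := by
    rw [hE₁]; linarith only [hy1, hπ, hE0]
  have hc0 : 0 ≤ 999 / 1000 * X r 0 ^ 2 / (θ * K ^ 9) := by positivity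
  by_cases hB0 : 0 ≤ 1916 / 1000 - 416 / 100 * E
  · have hη0 : 0 ≤ η := by linarith only [hη9]
    obtain ⟨hRpos, -⟩ := headline_band_radius hK hε hθ1 hR₂
    have hC0 : 0 ≤ K * X r 0 ^ 2 * η / (ε⁻¹ * K ^ 10 * (9999 / 10000) * R₂) := by positivity
    exact (mul_le_mul_of_nonneg_right hcoef hB0).trans
      ((mul_le_mul_of_nonneg_left (hB.trans hprice) hC0).trans hmain)
  · have hmono : X t₁ 4 ≤ X t₂ 4 := RotorKnob.rotorCircuit_output_monotone hK0.le hX ht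
    have hneg : 999 / 1000 * X r 0 ^ 2 / (θ * K ^ 9) * (1916 / 1000 - 416 / 100 * E) ≤ 0 :=
      mul_nonpos_of_nonneg_of_nonpos hc0 (le_of_lt (not_le.1 hB0))
    linarith only [hmono, hneg]

/-- §299(b) THE TWO-SIDED HEADLINE SWING (the hypotheses of §299(a) = part 104 §286):
`(999/1000)·a(r)²/(θK⁹)·(1.916 - 4.16E) ≤ ã(t₂) - ã(t₁) ≤ (1 + 2/10⁴)·a(r)²/(θK⁹)·(1.96 + 4.16E)`
— one band swing of the headline member bracketed by the same closed form from both sides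
(coefficients `0.12 %` apart, brackets `2.3 %` apart at `E = 0`).
[derived: this file §299(a); part 104 §286] -/
theorem swing_headline_two_sided
    (hX : ∀ t, HasDerivAt X (RotorKnob.rotorCircuit K (K ^ 10) ε ρ (X t)) t)
    (h0 : X 0 = delayInit) (hC : ∀ t, HasDerivAt C (X t 2) t) (hK : 16 ≤ K) (hε : 0 < ε)
    (hlat : ε = K ^ 10 * ρ ^ 2) {r t₁ t₂ T' θ : ℝ} (hr : 0 ≤ r) (hrt : r ≤ t₁) (ht : t₁ ≤ t₂)
    (htT : t₂ ≤ T') (hτ : T' - r ≤ 242 / K ^ 9) (hθ1 : 5 / 4 ≤ θ) (ha : X r 0 ≠ 0)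
    (hcr : X r 2 = ρ ^ 2 / K ^ 9)
    (hring : ∀ u ∈ Icc r T', θ ^ 2 * ε ^ 2 - ε ^ 2 / 10 ^ 6 ≤ X u 1 ^ 2 + X u 2 ^ 2 ∧
      X u 1 ^ 2 + X u 2 ^ 2 ≤ θ ^ 2 * ε ^ 2 + 2 * ε ^ 2 / 10 ^ 6)
    (hpos : ∀ u ∈ Icc r T', 0 < X u 2) (hb1 : X t₁ 1 = 31 / 32 * θ * ε)
    (hb2 : X t₂ 1 = -(31 / 32 * θ * ε))
    (hband : ∀ u ∈ Icc t₁ t₂, -(31 / 32 * θ * ε) ≤ X u 1 ∧ X u 1 ≤ 31 / 32 * θ * ε)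
    (hdlo : 31 / 32 * θ * K ^ 10 * (C t₁ - C r) ≤ X t₁ 2 - X r 2)
    (hdhi : X t₁ 2 - X r 2 ≤ (1 + 1 / 10 ^ 4) * θ * K ^ 10 * (C t₁ - C r)
      + ρ ^ 2 * exp (-K ^ 10) * (t₁ - r)) {E : ℝ}
    (hE : E = (|X r 3| + X r 3 ^ 2 + 6 * (ε + ρ ^ 2 * exp (-K ^ 10) + K * X T' 4) * (T' - r))
      / X r 0 ^ 2) :
    999 / 1000 * X r 0 ^ 2 / (θ * K ^ 9) * (1916 / 1000 - 416 / 100 * E) ≤ X t₂ 4 - X t₁ 4 ∧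
      X t₂ 4 - X t₁ 4
        ≤ (1 + 2 / 10 ^ 4) * X r 0 ^ 2 / (θ * K ^ 9) * (196 / 100 + 416 / 100 * E) :=
  ⟨swing_headline_floor hX h0 hC hK hε hlat hr hrt ht htT hτ hθ1 ha hcr hring hpos hb1 hb2 hband
      hdlo hdhi hE,
    swing_headline_price hX h0 hC hK hε hlat hr hrt ht htT hτ hθ1 ha hcr hring hpos hb1 hb2 hband
      hdlo hdhi hE⟩

/-- §299(c) THE PER-BAND NUMBER (the hypotheses of §299(a), plus `a(r)² ≥ 979/1000`,
`θ ≤ 29/20`, `E ≤ 10⁻³` — the carrier, ring and drift data a clean misfire of the ladder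
carries): `ã(t₂) - ã(t₁) ≥ 1.289/K⁹` (`0.999·0.979·(1.916 - 0.00416)/1.45 = 1.2895`; part 71's
crude floor is `1/K⁹` per clean misfire, so the re-count of part 72 §219 — part 113 — will give
the necessity ceiling `K⁹/(7·1.289) + 1 ≈ 0.1108K⁹ + 1` in place of `K⁹/7 + 1`; a FORECAST until
then).
[derived: this file §299(a); numerics] -/
theorem swing_headline_floor_band
    (hX : ∀ t, HasDerivAt X (RotorKnob.rotorCircuit K (K ^ 10) ε ρ (X t)) t)
    (h0 : X 0 = delayInit) (hC : ∀ t, HasDerivAt C (X t 2) t) (hK : 16 ≤ K) (hε : 0 < ε)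
    (hlat : ε = K ^ 10 * ρ ^ 2) {r t₁ t₂ T' θ : ℝ} (hr : 0 ≤ r) (hrt : r ≤ t₁) (ht : t₁ ≤ t₂)
    (htT : t₂ ≤ T') (hτ : T' - r ≤ 242 / K ^ 9) (hθ1 : 5 / 4 ≤ θ) (hθ2 : θ ≤ 29 / 20)
    (ha2 : 979 / 1000 ≤ X r 0 ^ 2) (hcr : X r 2 = ρ ^ 2 / K ^ 9)
    (hring : ∀ u ∈ Icc r T', θ ^ 2 * ε ^ 2 - ε ^ 2 / 10 ^ 6 ≤ X u 1 ^ 2 + X u 2 ^ 2 ∧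
      X u 1 ^ 2 + X u 2 ^ 2 ≤ θ ^ 2 * ε ^ 2 + 2 * ε ^ 2 / 10 ^ 6)
    (hpos : ∀ u ∈ Icc r T', 0 < X u 2) (hb1 : X t₁ 1 = 31 / 32 * θ * ε)
    (hb2 : X t₂ 1 = -(31 / 32 * θ * ε))
    (hband : ∀ u ∈ Icc t₁ t₂, -(31 / 32 * θ * ε) ≤ X u 1 ∧ X u 1 ≤ 31 / 32 * θ * ε)
    (hdlo : 31 / 32 * θ * K ^ 10 * (C t₁ - C r) ≤ X t₁ 2 - X r 2)
    (hdhi : X t₁ 2 - X r 2 ≤ (1 + 1 / 10 ^ 4) * θ * K ^ 10 * (C t₁ - C r)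
      + ρ ^ 2 * exp (-K ^ 10) * (t₁ - r)) {E : ℝ}
    (hE : E = (|X r 3| + X r 3 ^ 2 + 6 * (ε + ρ ^ 2 * exp (-K ^ 10) + K * X T' 4) * (T' - r))
      / X r 0 ^ 2) (hEs : E ≤ 1 / 1000) :
    1289 / 1000 / K ^ 9 ≤ X t₂ 4 - X t₁ 4 := by
  have hK0 : (0 : ℝ) < K := by linarith
  have hθ0 : (0 : ℝ) < θ := by linarith
  have hK9 : (0 : ℝ) < K ^ 9 := by positivity
  have ha : X r 0 ≠ 0 := by
    intro h
    rw [h] at ha2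
    norm_num at ha2
  have hfl := swing_headline_floor hX h0 hC hK hε hlat hr hrt ht htT hτ hθ1 ha hcr hring hpos hb1
    hb2 hband hdlo hdhi hE
  refine le_trans ?_ hfl
  have e : 999 / 1000 * X r 0 ^ 2 / (θ * K ^ 9) * (1916 / 1000 - 416 / 100 * E)
      = 999 / 1000 * X r 0 ^ 2 * (1916 / 1000 - 416 / 100 * E) / (θ * K ^ 9) := by ring
  rw [e, div_le_div_iff₀ hK9 (by positivity)]
  have hB1 : 191184 / 100000 ≤ 1916 / 1000 - 416 / 100 * E := by linarith only [hEs]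
  have hP : 979 / 1000 * (191184 / 100000) ≤ X r 0 ^ 2 * (1916 / 1000 - 416 / 100 * E) :=
    mul_le_mul ha2 hB1 (by norm_num) (sq_nonneg _)
  nlinarith only [mul_le_mul_of_nonneg_right hP hK9.le, mul_le_mul_of_nonneg_right hθ2 hK9.le,
    hK9]

end Summit.NavierStokesRegularity.FluidComputer.GateBudget
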